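import Summits.RiemannHypothesis.RiemannHypothesis.Theses.SpectralTrace
import Summits.RiemannHypothesis.RiemannHypothesis.Theorems.SpectralTraceWindowCompactness

/-!
# RiemannHypothesis / SpectralTrace — the support item `SpectralConverse` (RH ⇒ X)

Route `RiemannHypothesis/SpectralTrace`, item stmt-RiemannHypothesis-0193 (`SpectralConverse`,
support, rank 4), the calibration half "RH → X":

  `Summit.RiemannHypothesis → ∃ (ι : Type) (γ : ι → ℝ), ∀ g, IsWeilTest g →
      HasSum (fun i => weilMellin g (1/2 + i γ_i)) (weilFunctional g)`.

Proof. Take `ι = Σ ρ : riemannZetaNontrivialZeros, Fin m(ρ)` (the non-trivial zeros repeated with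
their multiplicity `m(ρ) = riemannZetaZeroOrder ρ`) and `γ ⟨ρ, k⟩ = Im ρ`. Unconditionally the zeros
with multiplicity are a COMPLEX spectrum for the Weil functional: for every Weil test `g`,
`HasSum (p ↦ ĝ(ρ_p)) (W g)` — the Guinand–Weil explicit formula in the tree's normalisation
(`Literature.NumberTheory.LFunctions.explicit_formula_holds`) together with the absolute
convergence of the zero side (`summable_norm_zeroSide`: rapid decay of `ĝ` on vertical strips and
`N(T) ≪ T log T`), regrouped on the sigma type (tree theorem
`Theorems.WindowTraceArch.Negative.hasSum_weilMellin_zeros`). Under the Riemann Hypothesis every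
non-trivial zero reads `ρ = 1/2 + i Im ρ` (`eq_half_add_of_riemannHypothesis`), so the same family,
read through its (real) ordinates, is the required real spectrum; this composition is the accepted
tree theorem `Theorems.spectralThesis_of_riemannHypothesis`
(`Theorems/SpectralTraceWindowCompactness.lean`), stated for Mathlib's `RiemannHypothesis`, and
`Summit.RiemannHypothesis` is that statement by `Summit.RiemannHypothesis_iff` (`Iff.rfl`). This file
states the result with the literal route type. It shows that the route thesis `X`
(`SpectralThesis`) is not stronger than RH.

References: A. Weil, *Sur les "formules explicites" de la théorie des nombres premiers* (1952);
E. Bombieri, *Remarks on Weil's quadratic functional in the theory of prime numbers I*, Rend. Mat.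
Acc. Lincei (9) 11 (2000), Thm. 2; H. L. Montgomery, R. C. Vaughan, *Multiplicative Number
Theory I*, Thm. 12.13.
-/

namespace Summit.RiemannHypothesis.RiemannHypothesis.Theorems

open Summit.RiemannHypothesis.RiemannHypothesis.Theses.SpectralTrace

/-- **Calibration `RH → X`** (support item stmt-RiemannHypothesis-0193, `SpectralConverse`): under
the Riemann Hypothesis the ordinates of the non-trivial zeros of `ζ`, repeated with multiplicity
(index type `Σ ρ : riemannZetaNontrivialZeros, Fin m(ρ)`, `γ ⟨ρ, k⟩ = Im ρ`), form a real family
`γ` with `HasSum (i ↦ ĝ(1/2 + iγ_i)) (W g)` for every Weil test `g` — the explicit formula with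
absolute convergence read on the critical line (`spectralThesis_of_riemannHypothesis`), transported
along `Summit.RiemannHypothesis_iff`. [Bombieri2000Weil, Thm. 2; Weil1952] -/
theorem spectralConverse_proof : SpectralConverse := by
  unfold SpectralConverse
  intro hRH
  exact spectralThesis_of_riemannHypothesis (Summit.RiemannHypothesis_iff.mp hRH)

end Summit.RiemannHypothesis.RiemannHypothesis.Theorems
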